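import Summits.Ventures.HSemireg.Pad4TowerPermCovarianceStatic

/-!
# Cruxes ∕ BlochSeedDiscOne — THE A♭_h FAMILY IS `G₁`-COVARIANT (kernel certificate for the orbit-mode encoder v21 `JOB_AFLAT=1`; anomaly lens g5)

HONEST FRAMING. Lens seat `plan-lens-HodgeAV-anomaly` g5 (director-hodge req-36, R16.51 (2)(a)), crux of record stmt-HodgeConjecture-18881
`BlochSeedDiscOne` (skeleton `Lines/birth.lean` 814a6a70c14e831a UNTOUCHED). Census-neutral: theorems ABOUT THE TYPED STATIC PREDICATES of record
(`A2IMinusClosed`, `XresA2IFires` of `Pad4TowerXresFamilies`; `MConfig.dual` of `Pad4TowerRuleDMu4Dual`; `MConfig.permImage` ∕ `MConfig.phaseImage`);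
nothing here is an object, a σ, a seed or a census row. NOTHING HERE SAYS THAT HC ∕ HC_CM ∕ HC_AV ∕ H2 ∕ 18881 HOLDS OR FAILS (HC_CM is a displayed
binder of the ladder only). No `sorry`, no `axiom`, no `instance`, no notation, no Literature fact; no new `def … : Prop`.

WHAT. The b-leg family **A♭_h(C) := `A2IMinusClosed (C.dual h)`** (anomaly LEMMA A∪2I♭, `Cruxes/BlochSeedDiscOne/LemmaA2IFlat.lean` `A2IFlatClosed`;
`MirrorTestA9.lean` spells it the same way) is invariant under the whole symmetry the census encoder quotients by — the factor permutations `S₄`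
(LEMMA P) and the factorwise torus `(ℤ∕4)⁴ ⊇ ⟨Δ⟩` (LEMMA T) — LITERAL-WISE for `S₄` (`aFlatFires_perm`: one A♭_h instance permuted is an A♭_h
instance) and FAMILYWISE for both (`aFlat_permImage`, `aFlat_phaseImage`, bundled `aFlatFamily_wreathInvariant`). INPUTS (all in the tree): LEMMA P
`dual_permImage` (any height) + `xresA2IFires_perm` ∕ `a2iMinusClosed_permImage`; LEMMA T `a2iMinusClosed_phaseImage` + the height-`h` version of its
`dual_phaseImage` proved here (`dual_phaseImage_height`; LEMMA T states `h = 0` only). So director-hodge R16.51 (2)(a) «the README NAMES the kernel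
theorem(s) … that cover the A♭ family literal-wise» has the answer: THIS FILE for covariance (orbit-mode soundness of the quotient, exactly what LEMMA
T + LEMMA P certify for the four families of record), while the SOUNDNESS of A♭_h as a necessary condition on real designs stays «LEMMA A∪2I♭ refereed
×1 (R16.28 (2)) + Binder 1 (A11), not kernel» — two different things. The mirror-X family needs nothing new: ι_h(X⁺) = X⁻ (LEMMA X♭,
`MirrorTestA9.xPlusClosed_dual_iff`) is a family of record, covered by `xMinusClosed_permImage` ∕ `xMinusClosed_phaseImage`.

§3 is the KERNEL-CERTIFIED SMOKE ROW for v21 (`decide`): on the three-cell survivor fragment `smokeFrag8` = {E₋ = {[8I ∣ x ∣ x ∣ x]}, E₊ = {[x]⁴,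
[8I ∣ 4I+2ℓ_u ∣ x ∣ x]}}, `x = 6I+ℓ_u = (7,1,0)` (= `LemmaA2IFlat.flatFrag8` = `MirrorTestA9.frag9`, same cells), all FOUR families of record are
CLOSED and A♭₈ is NOT, with EXACTLY TWO firing instances, both on the participants {P, N, P″} with no escape (`smokeFrag8_probe` (b)–(e)): an
encoder run in support-only check mode on this fragment with {X⁻, X⁺, A2I⁻, A2I⁺, A♭₈} must report 2 A♭ instances (heads `P[6I+ℓ_u]⁴` and
`P[8I ∣ 4I+2ℓ_u ∣ 6I+ℓ_u ∣ 6I+ℓ_u]`), both P-classes killed by A♭₈ ONLY, and no kill with the flag off.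
-/

namespace Summit.Ventures.HSemireg.Pad4Tower

namespace AnomalyLens

open Finset

/-! ## §1 The dual at any height commutes with the factorwise torus (LEMMA T `dualPt_phasePt` ∕ `dual_phaseImage` are the case `h = 0`) -/

/-- the height-`h` dual commutes with a factor rotation, pointwise. -/
theorem dualPt_phasePt_height (h : ℤ) (n : Fin 4) (x : BPoint) : dualPt h (phasePt n x) = phasePt n (dualPt h x) := by
  obtain ⟨a, b, c⟩ := x; fin_cases n <;> simp [dualPt, phasePt]

/-- … on cells … -/
theorem dualCell_phase_height (h : ℤ) (η : PVec) (Z : MCell) : dualCell h (Z.phase η) = (dualCell h Z).phase η := by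
  funext f; simp [dualCell, phase_apply, dualPt_phasePt_height]

/-- … and on configurations: `(η·C)^{ι_h} = η·(C^{ι_h})`. -/
theorem dual_phaseImage_height (h : ℤ) (η : PVec) (C : MConfig) : (C.phaseImage η).dual h = (C.dual h).phaseImage η := by
  simp only [MConfig.dual, MConfig.phaseImage, Finset.image_image, MConfig.mk.injEq]
  constructor <;> (congr 1; funext X; exact dualCell_phase_height h η X)

/-! ## §2 A♭_h is `S₄`-covariant (literal-wise) and torus-blind; hence `G₁ = ⟨Δ⟩ × S₄`- and `(ℤ∕4) ≀ S₄`-invariant -/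

/-- **one A♭_h instance, permuted** (literal-wise covariance; LEMMA P `xresA2IFires_perm` read on the `h`-dual via `dual_permImage`,
`dualCell_perm`): the clause of record fires on `(τ·C)^{ι_h}` at the ι_h-images of the permuted cells iff it fires on `C^{ι_h}` at the ι_h-images
with head ∕ escort factors `τ σ`, `τ f'`. -/
theorem aFlatFires_perm (h : ℤ) (τ : Equiv.Perm (Fin 4)) (C : MConfig) (Z q N' : MCell) (σ u f' v : Fin 4) :
    XresA2IFires ((C.permImage τ).dual h) (dualCell h (Z.perm τ)) (dualCell h (q.perm τ)) (dualCell h (N'.perm τ)) σ u f' v ↔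
      XresA2IFires (C.dual h) (dualCell h Z) (dualCell h q) (dualCell h N') (τ σ) u (τ f') v := by
  rw [dual_permImage, dualCell_perm, dualCell_perm, dualCell_perm, xresA2IFires_perm]

/-- **A♭_h is `S₄`-covariant**: `A2IMinusClosed ((τ·C)^{ι_h}) ↔ A2IMinusClosed (C^{ι_h})`, every height. -/
theorem aFlat_permImage (h : ℤ) (τ : Equiv.Perm (Fin 4)) (C : MConfig) :
    A2IMinusClosed ((C.permImage τ).dual h) ↔ A2IMinusClosed (C.dual h) := by
  rw [dual_permImage, a2iMinusClosed_permImage]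

/-- **A♭_h is torus-blind** (in particular `Δ`-invariant): `A2IMinusClosed ((η·C)^{ι_h}) ↔ A2IMinusClosed (C^{ι_h})`, every height. -/
theorem aFlat_phaseImage (h : ℤ) (η : PVec) (C : MConfig) :
    A2IMinusClosed ((C.phaseImage η).dual h) ↔ A2IMinusClosed (C.dual h) := by
  rw [dual_phaseImage_height, a2iMinusClosed_phaseImage]

/-- **THE A♭_h FAMILY IS `(ℤ∕4) ≀ S₄`-INVARIANT, familywise** (both generators; `G₁ = ⟨Δ⟩ × S₄` is a subgroup): the orbit-mode quotient of the
encoder (`JOB_ORBIT=g1`, one variable per `G₁`-orbit × level, heads = orbit representatives) is as sound for A♭_h as LEMMA T + LEMMA P make it for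
the four families of record. -/
theorem aFlatFamily_wreathInvariant (h : ℤ) (η : PVec) (τ : Equiv.Perm (Fin 4)) (C : MConfig) :
    (A2IMinusClosed ((C.phaseImage η).dual h) ↔ A2IMinusClosed (C.dual h)) ∧
      (A2IMinusClosed ((C.permImage τ).dual h) ↔ A2IMinusClosed (C.dual h)) :=
  ⟨aFlat_phaseImage h η C, aFlat_permImage h τ C⟩

/-- the two-sided game (c⁺) ⊇ (c) = H₁ + A♭_h ⊇ (c♭) = RULE-D + {X⁻, A♭_h}, conjunct by conjunct `S₄`-invariant (RULE-D, X⁻, X⁺, A2I⁻ by LEMMA P;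
A♭_h by `aFlat_permImage`). -/
theorem mirrorGame_permImage (h : ℤ) (τ : Equiv.Perm (Fin 4)) (C : MConfig) :
    (RuleDMu4Closed (C.permImage τ) ↔ RuleDMu4Closed C) ∧ (XMinusClosed (C.permImage τ) ↔ XMinusClosed C) ∧
      (XPlusClosed (C.permImage τ) ↔ XPlusClosed C) ∧ (A2IMinusClosed (C.permImage τ) ↔ A2IMinusClosed C) ∧
      (A2IMinusClosed ((C.permImage τ).dual h) ↔ A2IMinusClosed (C.dual h)) :=
  ⟨ruleDMu4Closed_permImage τ C, xMinusClosed_permImage τ C, xPlusClosed_permImage τ C, a2iMinusClosed_permImage τ C,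
    aFlat_permImage h τ C⟩

/-- … and torus-invariant (RULE-D, X⁻, X⁺, A2I⁻ by LEMMA T; A♭_h by `aFlat_phaseImage`). -/
theorem mirrorGame_phaseImage (h : ℤ) (η : PVec) (C : MConfig) :
    (RuleDMu4Closed (C.phaseImage η) ↔ RuleDMu4Closed C) ∧ (XMinusClosed (C.phaseImage η) ↔ XMinusClosed C) ∧
      (XPlusClosed (C.phaseImage η) ↔ XPlusClosed C) ∧ (A2IMinusClosed (C.phaseImage η) ↔ A2IMinusClosed C) ∧
      (A2IMinusClosed ((C.phaseImage η).dual h) ↔ A2IMinusClosed (C.dual h)) :=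
  ⟨ruleDMu4Closed_phaseImage η C, xMinusClosed_phaseImage η C, xPlusClosed_phaseImage η C, a2iMinusClosed_phaseImage η C,
    aFlat_phaseImage h η C⟩

/-! ## §3 The kernel-certified smoke row for v21 (`decide`): four families of record closed, A♭₈ fires once -/

section Probes

set_option synthInstance.maxSize 8192
set_option synthInstance.maxHeartbeats 2000000

/-- the survivor letter `x = 6I+ℓ_u = (7,1,0)` (node `6`, charge `1`, phase index `0`; upper node `8I`). -/
def xSmoke : BPoint := ray (6, 0, 0) 0 1

/-- **the smoke fragment** `{E₋ = {[8I ∣ x ∣ x ∣ x]}, E₊ = {[x]⁴, [8I ∣ 4I+2ℓ_u ∣ x ∣ x]}}` ⊂ ◇₈ (= `LemmaA2IFlat.flatFrag8` = `MirrorTestA9.frag9`;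
NOT RULE-D-closed — a support-only CHECK row, not a design). In the encoder's JSON (`JOB_SUPPORT`, points `[α, Re β, Im β]`):
`{"N": {"n1": [[8,0,0],[7,1,0],[7,1,0],[7,1,0]]}, "P": {"p1": [[7,1,0],[7,1,0],[7,1,0],[7,1,0]], "p2": [[8,0,0],[6,2,0],[7,1,0],[7,1,0]]}}`. -/
def smokeFrag8 : MConfig where
  lower := {mcellOf (8, 0, 0) xSmoke xSmoke xSmoke}
  upper := {mcellOf xSmoke xSmoke xSmoke xSmoke, mcellOf (8, 0, 0) (ray (4, 0, 0) 0 2) xSmoke xSmoke}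

/-- the three cells, named: `P = [x]⁴` (the census survivor), `N = [8I ∣ x ∣ x ∣ x]` (its b-lift on factor 0), `P″ = [8I ∣ 4I+2ℓ_u ∣ x ∣ x]`. -/
def smokeP : MCell := mcellOf xSmoke xSmoke xSmoke xSmoke
/-- see `smokeP`. -/
def smokeN : MCell := mcellOf (8, 0, 0) xSmoke xSmoke xSmoke
/-- see `smokeP`. -/
def smokePpp : MCell := mcellOf (8, 0, 0) (ray (4, 0, 0) 0 2) xSmoke xSmoke

/-- the fragment's levels are the named cells. [rfl] -/
theorem smokeFrag8_eq : smokeFrag8.lower = {smokeN} ∧ smokeFrag8.upper = {smokeP, smokePpp} := ⟨rfl, rfl⟩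

/-- **SMOKE ROW** [kernel, `decide`]: (a) the fragment lies in ◇₈; (b) the four instance families OF RECORD are CLOSED on it (`X⁻`, `X⁺`, `A2I⁻`,
`A2I⁺` — no kill); (c) A♭₈ is NOT closed: the clause of record fires on the 8-dual at EXACTLY TWO instances (d): at the image of (head `P = [x]⁴`;
`σ = 0`, `u = 2`; partner `N`; `f′ = 1`, `v = 2`; server `P″`) — i.e. at the floor unit `[ℓ₂]⁴` of the dual (W17 round 11, letter for letter) — and at
the image of (head `P″`; `σ = 1`, `u = 2`; partner `N` at guard depth `1 ≤ cabs = 2`; `f′ = 0`, `v = 2`; server `P`); both instances have the SAME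
three participants {P, N, P″} and no escape, so they are one clause `¬P ∨ ¬N ∨ ¬P″`; (e) no other (head, partner, server, σ, u, f′, v) fires.
Expected v21 support-only CHECK output on this support with the five families {X⁻, X⁺, A2I⁻, A2I⁺, A♭₈} on: A♭ instances generated = 2 (heads
`P[6I+ℓ_u|6I+ℓ_u|6I+ℓ_u|6I+ℓ_u]` and `P[8I|4I+2ℓ_u|6I+ℓ_u|6I+ℓ_u]`, escape lists empty), `killed columns = 2` (both P-classes, family A♭ only),
`alive_N = [N[8I|6I+ℓ_u|6I+ℓ_u|6I+ℓ_u]]`, nothing killed by X ∕ A2I; with `JOB_AFLAT=0`: no kill at all. -/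
theorem smokeFrag8_probe :
    smokeFrag8.InDiamond 8 ∧
    XMinusClosed smokeFrag8 ∧ XPlusClosed smokeFrag8 ∧ A2IMinusClosed smokeFrag8 ∧ A2IPlusClosed smokeFrag8 ∧
    ¬ A2IMinusClosed (smokeFrag8.dual 8) ∧
    XresA2IFires (smokeFrag8.dual 8) (dualCell 8 smokeP) (dualCell 8 smokeN) (dualCell 8 smokePpp) 0 2 1 2 ∧
    XresA2IFires (smokeFrag8.dual 8) (dualCell 8 smokePpp) (dualCell 8 smokeN) (dualCell 8 smokeP) 1 2 0 2 ∧
    (∀ Z ∈ (smokeFrag8.dual 8).lower, ∀ q ∈ (smokeFrag8.dual 8).upper, ∀ N' ∈ (smokeFrag8.dual 8).lower, ∀ σ u f' v : Fin 4,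
      XresA2IFires (smokeFrag8.dual 8) Z q N' σ u f' v →
        (Z = dualCell 8 smokeP ∧ N' = dualCell 8 smokePpp ∧ σ = 0 ∧ u = 2 ∧ f' = 1 ∧ v = 2) ∨
        (Z = dualCell 8 smokePpp ∧ N' = dualCell 8 smokeP ∧ σ = 1 ∧ u = 2 ∧ f' = 0 ∧ v = 2)) := by
  refine ⟨by decide +kernel, by decide +kernel, by decide +kernel, by decide +kernel, by decide +kernel, by decide +kernel, by decide +kernel,
    by decide +kernel, by decide +kernel⟩

end Probes

end AnomalyLens

end Summit.Ventures.HSemireg.Pad4Tower
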